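import Mathlib
import Summits.Ventures.HodgeRepro2.A1EigenlinePermutation
import Summits.Ventures.HodgeRepro2.A1GaloisTensorSplitting
import Summits.Ventures.HodgeRepro2.A1EigenlineDecompositionGalois

/-!
# The dimension of the eigenlines: `dim_L V_σ = dim_F V`

Blind cell `pub-hodge-repro2`, seat p7 (gen 10), A1 annex (route/T4-A1-p7.md (A0.4): «each
`ℓ_{i,σ}` has dimension exactly 1» — `dim_F H¹(A_i, ℚ) = 1 ⇒ dim_ℂ ℓ_{i,σ} = 1`, recorded in
route/LEAN-ANNEX-p7.md §2p as not attempted).  With the decomposition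
`L ⊗[K] V = ⊕_σ V_σ` (`A1EigenlineDecompositionGalois`) the dimension count is elementary:

* `proj σ : V → V_σ`, `v ↦ ρ (idem σ) (1 ⊗ v)`, is `σ`-semilinear over `F` (`proj_smul`) and its
  image `L`-spans `V_σ` (`eigenline_eq_span_range_proj`); so an `F`-basis of `V` of size
  `d = dim_F V` gives an `L`-spanning family of `V_σ` of size `d`: `dim_L V_σ ≤ d`;
* the `V_σ` are independent and span `L ⊗[K] V`, whose `L`-dimension is
  `dim_K V = [F : K] · d`; with `[F : K]` embeddings this forces `dim_L V_σ = d` for every `σ`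
  (**`finrank_eigenline`**).

README §8(d): uses an L-value-free non-vanishing device: NO.
-/

namespace Summit.Ventures.HodgeRepro2.A1EigenlineDimension

open TensorProduct
open Summit.Ventures.HodgeRepro2.A1EigenlinePermutation
open Summit.Ventures.HodgeRepro2.A1GaloisTensorSplitting
open Summit.Ventures.HodgeRepro2.A1EigenlineDecompositionGalois

variable (K L : Type*) [Field K] [Field L] [Algebra K L]
variable (F : Type*) [Field F] [Algebra K F] [FiniteDimensional K F]
variable (V : Type*) [AddCommGroup V] [Module K V] [Module F V] [IsScalarTower K F V]
variable [Fintype (Emb K L F)] [DecidableEq (Emb K L F)]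
  (hcard : Fintype.card (Emb K L F) = Module.finrank K F)

section Proj

/-- The `σ`-component of `1 ⊗ v`: `proj σ v = ρ (idem σ) (1 ⊗ v) ∈ V_σ`. -/
noncomputable def proj (σ : Emb K L F) (v : V) : L ⊗[K] V :=
  ρ K L F V (idem K L F hcard σ) ((1 : L) ⊗ₜ[K] v)

/-- `proj σ v ∈ V_σ`. -/
theorem proj_mem_eigenline (σ : Emb K L F) (v : V) : proj K L F V hcard σ v ∈ eigenline L V σ :=
  ρ_idem_mem_eigenline K L F V hcard σ _

/-- `proj σ` is additive. -/
theorem proj_add (σ : Emb K L F) (v w : V) :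
    proj K L F V hcard σ (v + w) = proj K L F V hcard σ v + proj K L F V hcard σ w := by
  simp [proj, TensorProduct.tmul_add]

/-- **`proj σ` is `σ`-semilinear over `F`**: `proj σ (x • v) = σ x • proj σ v`. -/
theorem proj_smul (σ : Emb K L F) (x : F) (v : V) :
    proj K L F V hcard σ (x • v) = σ x • proj K L F V hcard σ v := by
  have h : (1 : L) ⊗ₜ[K] (x • v) = actF L x ((1 : L) ⊗ₜ[K] v) := by rw [actF_tmul]
  rw [proj, proj, h, ← ρ_one_tmul K L F V x, ← Module.End.mul_apply, ← map_mul,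
    mul_comm, one_tmul_mul_idem, map_smul, LinearMap.smul_apply]

/-- `proj σ` of a finite `F`-linear combination. -/
theorem proj_sum_smul {ι : Type*} (s : Finset ι) (σ : Emb K L F) (c : ι → F) (v : ι → V) :
    proj K L F V hcard σ (∑ i ∈ s, c i • v i) = ∑ i ∈ s, σ (c i) • proj K L F V hcard σ (v i) := by
  classical
  induction s using Finset.induction_on with
  | empty => simp [proj]
  | insert a s ha ih => rw [Finset.sum_insert ha, Finset.sum_insert ha, proj_add, proj_smul, ih]

/-- `ρ (idem σ) (c ⊗ v) = c • proj σ v`. -/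
theorem ρ_idem_tmul (σ : Emb K L F) (c : L) (v : V) :
    ρ K L F V (idem K L F hcard σ) (c ⊗ₜ[K] v) = c • proj K L F V hcard σ v := by
  rw [proj, ← LinearMap.map_smul, smul_tmul', smul_eq_mul, mul_one]

/-- **`V_σ` is `L`-spanned by the `proj σ (b j)`** for an `F`-basis `b` of `V`. -/
theorem eigenline_eq_span_range_proj {ι : Type*} [Fintype ι] (b : Module.Basis ι F V)
    (σ : Emb K L F) :
    eigenline L V σ = Submodule.span L (Set.range (fun j => proj K L F V hcard σ (b j))) := by
  apply le_antisymm
  · intro m hm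
    have hm' : ρ K L F V (idem K L F hcard σ) m = m := by
      rw [ρ_idem_apply_of_mem_eigenline K L F V hcard σ σ hm, if_pos rfl]
    rw [← hm']
    clear hm hm'
    induction m using TensorProduct.induction_on with
    | zero => simp
    | tmul c v =>
      rw [ρ_idem_tmul]
      refine Submodule.smul_mem _ _ ?_
      rw [← b.sum_repr v, proj_sum_smul]
      exact Submodule.sum_mem _ fun j _ =>
        Submodule.smul_mem _ _ (Submodule.subset_span ⟨j, rfl⟩)
    | add a b ha hb => rw [map_add]; exact Submodule.add_mem _ ha hb
  · rw [Submodule.span_le]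
    rintro _ ⟨j, rfl⟩
    exact proj_mem_eigenline K L F V hcard σ _

/-- `dim_L V_σ ≤ dim_F V`. -/
theorem finrank_eigenline_le (hcard : Fintype.card (Emb K L F) = Module.finrank K F)
    [FiniteDimensional F V] (σ : Emb K L F) :
    Module.finrank L (eigenline L V σ) ≤ Module.finrank F V := by
  rw [eigenline_eq_span_range_proj K L F V hcard (Module.finBasis F V) σ]
  exact (finrank_range_le_card _).trans (by simp)

end Proj

section Count

/-- `dim_L (L ⊗[K] V) = ∑_σ dim_L V_σ` (from the decomposition `L ⊗[K] V = ⊕_σ V_σ`). -/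
theorem finrank_eq_sum_finrank_eigenline (hcard : Fintype.card (Emb K L F) = Module.finrank K F)
    [FiniteDimensional K V] :
    Module.finrank L (L ⊗[K] V) = ∑ σ : Emb K L F, Module.finrank L (eigenline L V σ) := by
  have hint := isInternal_eigenline K L F V hcard
  haveI : FiniteDimensional L (L ⊗[K] V) := Module.Finite.base_change K L V
  haveI : ∀ σ : Emb K L F, FiniteDimensional L (eigenline L V σ) := fun σ =>
    FiniteDimensional.finiteDimensional_submodule _
  haveI : ∀ σ : Emb K L F, Module.Free L (eigenline L V σ) := fun σ =>
    Module.Free.of_divisionRing L (eigenline L V σ)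
  let bs := hint.collectedBasis (fun σ => Module.finBasis L (eigenline L V σ))
  rw [Module.finrank_eq_card_basis bs, Fintype.card_sigma]
  simp

omit [Fintype (Emb K L F)] [DecidableEq (Emb K L F)] in
/-- `dim_L (L ⊗[K] V) = [F : K] · dim_F V`. -/
theorem finrank_tensor_eq [FiniteDimensional F V] :
    Module.finrank L (L ⊗[K] V) = Module.finrank K F * Module.finrank F V := by
  rw [Module.finrank_baseChange, Module.finrank_mul_finrank K F V]

/-- **`dim_L V_σ = dim_F V` for every embedding `σ`** («each `ℓ_{i,σ}` has dimension exactly 1»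
when `dim_F H¹(A_i, ℚ) = 1`). -/
theorem finrank_eigenline (hcard : Fintype.card (Emb K L F) = Module.finrank K F)
    [FiniteDimensional F V] (σ : Emb K L F) :
    Module.finrank L (eigenline L V σ) = Module.finrank F V := by
  haveI : FiniteDimensional K V := Module.Finite.trans F V
  have hsum := finrank_eq_sum_finrank_eigenline K L F V hcard
  rw [finrank_tensor_eq K L F V, ← hcard, ← Finset.card_univ, ← smul_eq_mul,
    ← Finset.sum_const] at hsum
  have hle : ∀ τ ∈ (Finset.univ : Finset (Emb K L F)),
      Module.finrank L (eigenline L V τ) ≤ Module.finrank F V :=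
    fun τ _ => finrank_eigenline_le K L F V hcard τ
  exact (Finset.sum_eq_sum_iff_of_le hle).mp hsum.symm σ (Finset.mem_univ _)

/-- Over the Galois field itself (`F/K` finite Galois, `L = F`): `dim_F V_σ = dim_F V`. -/
theorem finrank_eigenline_self (K F : Type*) [Field K] [Field F] [Algebra K F]
    [FiniteDimensional K F] [IsGalois K F] (V : Type*) [AddCommGroup V] [Module K V] [Module F V]
    [IsScalarTower K F V] [FiniteDimensional F V] [DecidableEq (Emb K F F)] (σ : Emb K F F) :
    Module.finrank F (eigenline F V σ) = Module.finrank F V :=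
  finrank_eigenline K F F V (card_algHom_self K F) σ

end Count

end Summit.Ventures.HodgeRepro2.A1EigenlineDimension
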